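import Summits.CriticalPhenomena.CardyFormulaZ2.Theorems.CardyBoundaryCoulombGasHalfPlaneMarkDensityLawNearEndRegularity
import Summits.CriticalPhenomena.CardyFormulaZ2.Theorems.CardyBoundaryCoulombGasHalfPlaneMarkDensityLawWindowSecondMark

/-!
# `HalfPlaneMarkDensityLaw` (crux stmt-CriticalPhenomena-5661), line `Sketch`:
# `∂₂G > 0` densely in the second mark — glue form (DensePos P5')

For every joint subsequential limit `G` of the half-plane four-arc crossing probability along a strictly
increasing `θ`, the one-variable section `s ↦ G a s c y` (`c < y`) is differentiable on `(a,c)`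
(`NearEnd.differentiableOn_jointLimit_second`) and strictly increasing there
(`Window.stub_jointLimit_strictMono_second`).  Hence the real-analysis input P1' — a strictly increasing
function differentiable on `(u,v)` has positive derivative on a dense subset of `(u,v)` — applied to
`f := fun s ↦ G a s c y`, `u := a`, `v := c` gives: `∂₂G(a,·,c,y) > 0` on a dense subset of `(a,c)`.
-/

noncomputable section

namespace Summit.CriticalPhenomena.CardyFormulaZ2.Cruxes.HalfPlaneMarkDensityLaw.SketchLine

open Literature.Probability.Percolation Literature.Probability.LatticeModels
open MeasureTheory Filter Set
open scoped Topology
open Summit.CriticalPhenomena.CardyFormulaZ2.Theorems.HalfPlaneMarkDensityLaw.Negative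

namespace DensePos

/-- **P5' (glue): `∂₂G > 0` on a dense subset of `(a,c)`**, from the real-analysis input P1'
(a strictly increasing function differentiable on `(u,v)` has positive derivative densely in `(u,v)`),
`NearEnd.differentiableOn_jointLimit_second` and `Window.stub_jointLimit_strictMono_second`. [folklore] -/
theorem stub_deriv2_pos_dense_of :
    (∀ (f : ℝ → ℝ) (u v : ℝ), StrictMonoOn f (Ioo u v) → DifferentiableOn ℝ f (Ioo u v) →
      Ioo u v ⊆ closure {x | u < x ∧ x < v ∧ 0 < deriv f x}) →
    ∀ {θ : ℕ → ℕ} {G : ℝ → ℝ → ℝ → ℝ → ℝ},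
      (∀ a b c y : ℝ, a < b → b < c → c < y →
        Tendsto (fun n ↦ μ.real (openCrossing halfPlane (arcA a b (θ n))
          (rowIcc ⌊c * (θ n : ℕ)⌋ ⌊y * (θ n : ℕ)⌋))) atTop (𝓝 (G a b c y))) →
      StrictMono θ → ∀ {a c y : ℝ}, a < c → c < y →
        Ioo a c ⊆ closure {s | a < s ∧ s < c ∧ 0 < deriv (fun s ↦ G a s c y) s} := by
  intro hP θ G hG hθ a c y _ hcy
  have hmono : StrictMonoOn (fun s ↦ G a s c y) (Ioo a c) := by
    intro b hb b' hb' hbb'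
    exact Window.stub_jointLimit_strictMono_second hG hθ hb.1 hbb' hb'.2 hcy
  have hdiff : DifferentiableOn ℝ (fun s ↦ G a s c y) (Ioo a c) :=
    NearEnd.differentiableOn_jointLimit_second hG hθ.tendsto_atTop hcy
  exact hP (fun s ↦ G a s c y) a c hmono hdiff

end DensePos

end Summit.CriticalPhenomena.CardyFormulaZ2.Cruxes.HalfPlaneMarkDensityLaw.SketchLine
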